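import Summits.QuantumFields.YangMills.Theorems.FluctuationComparisonRegPrIntLS1aTowerDensityVersion
import Summits.QuantumFields.YangMills.Theorems.FluctuationComparisonRegPrIntLS1aProfileWindowChart
import Summits.QuantumFields.YangMills.Theorems.FluctuationComparisonRegPrIntLSpreadLiftAllL
import HarnessLib

/-!
# `FluctuationComparisonRegPrIntLS1aTowerFullWindow` — S1aᴴ's (p) ∧ (w) ON THE FULL WINDOW AT EVERY HEIGHT: every law of the cut tower has a measurable density
# STRICTLY POSITIVE on the whole `θBal F.L γ b₀ p₀ j`-window (the cut's own `b₀`), from a height; FILE C3 of the «(p) on the FULL window» road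

Cell `ym3-torus` (YM ladder rung R3 = continuum `SU(2)` Yang–Mills on T³ — NOT d = 4, NOT infinite volume, NOT a mass gap, NOT Clay); width seat
`ym3-torus-px21` (gen 22), WIDTH COPY of ★p1 «CMP 102 Thm 1's inputs AS PRINTED vs AS TYPED, every gap named».  Helper of the crux
`stmt-QuantumFields-20520` `FluctuationComparisonRegPrIntL` (`--kind proof --supports … --as helper`, count-neutral).  THEOREMS ONLY: definition-free,
default heartbeats, no `instance`∕`notation`.

WHY.  S1aᴴ `RunClassMembershipH` (`Lines/runpair_organ.lean` v18.4 :534) asks (p) «`0 < ρ_j` on the `θBal F.L γ b₀ p₀ j`-window» ∧ (w) «`μ j = dU_j.withDensity (ofReal ∘ ρ_j)`» for the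
CUT tower `μ j = (descend F ℰp j)_*((μ (j+1)).withDensity (χ (j+1)))`, `χ = ofReal ∘ sfCut (θBal … b₀ …)`.  ✓p819880 (`…S1aTowerDensityVersion`) pays (p) on the PLATEAU window
of the cut (`b₀∕2` at the cut heights); HOME UV3-NODE §67.3 and my 10:01Z located residual ask for the annulus.  THIS FILE closes it, for ANY measurable cut `χ ≤ 1` that is
NON-ZERO on the `c·θ`-windows, `c = 19∕20` (the line's `sfCut`: each ramp factor is `≥ (24∕25 − 19∕20)∕(24∕25 − 1∕2) > 0` there):
* §1 ★`exists_lift_profile` — INTERIOR for the two-parameter profile, by ITERATING the spread lift ✓`SpreadLiftAllL.spreadLift_height_all` (px12 g19; one-step exact lifts of gain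
  `κ√L < c` at every odd `L ≥ 3` from the tree's certified kernels): from a height `jV`, every `V` in the `θ_j`-window has, for every `K ≥ j`, a fine history `U` on run `K` with
  `descendTo j K U = V` and `descendTo n K U ∈ PlaqSmall (c·θ_n)` for all `j < n ≤ K` (`θ_i = θBal F.L γ b₀ p₀ i`).
* §2 ★★★`window_absolutelyContinuous_tower` — THE AC STEP: for `0 < γ ≤ γ₁(L, b₀, p₀)` and `j ≥ jV`: `μ j B = 0 ⟹ dU_j B = 0` for every measurable `B` inside the
  `θ_j`-window, i.e. `dU_j|_{W_j(b₀)} ≪ μ j`.  Proof: downward induction «`μ j B = 0 ⟹ Gibbs_K (E_j ∩ D_{j,K}⁻¹B) = 0`» with `E_j = {U | ∀ i ∈ (j, Ts], D_{i,K}U ∈ PlaqSmall (c·θ_i)}`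
  (one `withDensity`∕`map` evaluation per level: the cut weight is NON-ZERO on `E_j`'s next level, no constants needed), then `histGood F ℰp θ″ K j ⊆ E_j` for the profile
  `θ″ = (θ_i for i ≤ j; c·θ_i above)`, lit ✓`map_descendTo_restrict_eq_withDensity` and ✓C2 `…S1aProfileWindowChart.regSet_and_pos_profile` + §1 (positivity of the canonical
  `histGood θ″`-restricted density on the whole `θ_j`-window) + lit ✓`Node00.canonVersion_ae_eq`.
* §3 ★★★`exists_density_pos_on_fullWindow` — (p) ∧ (w) FOR ONE MEASURABLE VERSION ON THE FULL WINDOW: `ρ_j := (dμ_j∕dU).toReal` off the null set `W_j ∩ {dμ_j∕dU ∈ {0, ⊤}}`, `1` on it;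
  `μ j = dU_j.withDensity (ofReal ∘ ρ_j)`, `0 < ρ_j` on `{PlaqSmall (θBal F.L γ b₀ p₀ j)}`, and `ρ_j ≤ Z_K⁻¹·heightDensity … univ` a.e. (✓p819387 `tower_le_run`); ✓p819387
  `density_sandwich_ae` gives the `histGood`-lower edge for this `ρ_j` too wherever a plateau is available (it is stated for every version).
QUANTIFIER SHAPE = S1aᴴ's: `∀ L b₀ p₀ ∃ γ₁ ∀ F γ ∃ jV ∀ (runs, towers) ∀ j ≥ jV …` (S1aᴴ: `∃ j₀ … ∀ j, j₀ ≤ j`).  With ✓p819387∕✓p819880: UV3-NODE §67.3 rows (w) ✓ and (p) ✓ AS TYPED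
(the cut's own `b₀`-window, every height from `jV`), for one measurable version, under S1aᴴ's own binders and an abstract cut; (m3) ✓ as the a.e. sandwich sentence.
NOTHING of Bałaban's renormalisation-group analysis is asserted or proved: charts∕lifts∕Radon–Nikodym plumbing over landed kernel facts (WREG port, ✓`SpreadLiftAllL`, ✓C2).

HONEST: S1a(ᴴ): (m)-conjunct AS TYPED misstated by currency (★★OWNER RULING №80; repair (R-β1′) requested), AS PRINTED OPEN; (c)∕(a) untouched; the five registered stubs of
`Lines/semiclassical_s2beta.lean` (3732b7df) ∕ crux 20520 ∕ 19936 ∕ 19200 ∕ `YM3TorusSU2` NOT proved; registry untouched; rung R3 = SU(2) YM₃ on T³ at fixed lattice data —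
NOT d = 4, NOT infinite volume, NOT a mass gap, NOT Clay; the Yang–Mills mass gap is NOT proved by any of this.
References: [Balaban1985UV3] CMP 102 (1985) (2) p. 256, (7) p. 257, (47) p. 267; [Balaban1987RG1] CMP 109 (1987) (0.4)∕(0.11) p. 253, (0.18) p. 255, (2.10) p. 267;
[Balaban1985Averaging] CMP 98 (1985) (10) p. 19.
-/

set_option autoImplicit false

noncomputable section

namespace Summit.QuantumFields.YangMills.Theorems.FluctuationComparisonRegPrIntLS1aTowerFullWindow

open MeasureTheory Filter Topology Set Function
open scoped ENNReal NNReal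
open Literature.MathematicalPhysics.QuantumFieldTheory.Balaban1983to89
open T3ContinuumYM3Torus T3NestedUnitLaws T3UnitLawDensityEML T3UnitScaleTilt T3LevelShift T3TiltDescent T4Continuum
open Literature.MathematicalPhysics.QuantumFieldTheory.Balaban1983to89.Missing
open Literature.MathematicalPhysics.QuantumFieldTheory.Balaban1983to89.T3DescentFibreTower (descendTo_descendTo descendTo_self)
open scoped Literature.MathematicalPhysics.QuantumFieldTheory.Balaban1983to89.T3OrbitAverage
open Summit.QuantumFields.YangMills.Theorems.FluctuationComparisonRegPrIntLOrganTangentFibredChartDescendTo (descend_eq_descendTo')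
open Summit.QuantumFields.YangMills.Theorems.FluctuationComparisonRegPrIntLClassicalPerHeightSteps (histGood_iff_descendTo)
open Summit.QuantumFields.YangMills.Theorems.FluctuationComparisonRegPrIntLWregGlue (heightDensityCan)
open Summit.QuantumFields.YangMills.Theorems.FluctuationComparisonRegPrIntLWregInterior (isOpen_histGood)
open Summit.QuantumFields.YangMills.Theorems.FluctuationComparisonRegPrIntLS1aTowerLawSandwich
open Summit.QuantumFields.YangMills.Theorems.FluctuationComparisonRegPrIntLS1aTowerDensityVersion (isOpen_window)
open Summit.QuantumFields.YangMills.Theorems.FluctuationComparisonRegPrIntLS1aProfileWindowChart (regSet_and_pos_profile)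
open Summit.QuantumFields.YangMills.Theorems.SpreadLiftAllL (spreadLift_height_all)
open Literature.MathematicalPhysics.QuantumFieldTheory.Balaban1983to89.T3Thresholds (exists_gamma_forall_θBal_le)

/-! ## §1 INTERIOR for the two-parameter profile: iterate the spread lift -/

/-- ★ **ITERATED SPREAD LIFT**: for `c` above the lift floor and `c ≤ 1`, every family, `0 < γ ≤ 1`, `0 < b₀`, `0 ≤ p₀`: from a height `jV` on, every `V` in the `θ_j`-window
has, on EVERY run `K ≥ j`, a fine history `U` with `descendTo F ℰp j K U = V`, `U` in the `θ_K`-window, and `descendTo F ℰp n K U` in the `c·θ_n`-window for every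
`j < n ≤ K` (induction on `K` over ✓`spreadLift_height_all`; ✓`descend_eq_descendTo'`, lit ✓`descendTo_descendTo`∕`descendTo_self`).
[cite: Balaban1987RG1, (0.4) p.253, (0.11) p.253 and (0.18) p.255; Balaban1985UV3, (7) p.257] -/
theorem exists_lift_profile {c : ℝ} (hc : (3874825 / 7077888 : ℝ) * Real.sqrt ((3 : ℕ) : ℝ) < c) (hc1 : c ≤ 1) (F : T3Family)
    {γ b₀ p₀ : ℝ} (hγ : 0 < γ) (hγ1 : γ ≤ 1) (hb : 0 < b₀) (hp : 0 ≤ p₀) :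
    ∃ jV : ℕ, ∀ (j : ℕ), jV ≤ j → ∀ (K : ℕ) (hjK : j ≤ K) (V : GaugeField (F.P j) 0 ↥(Matrix.specialUnitaryGroup (Fin 2) ℂ)),
      PlaqSmall (θBal F.L γ b₀ p₀ j) V →
        ∃ U : GaugeField (F.P K) 0 ↥(Matrix.specialUnitaryGroup (Fin 2) ℂ), descendTo F ℰp j K hjK U = V ∧ PlaqSmall (θBal F.L γ b₀ p₀ K) U ∧
          ∀ (n : ℕ) (_ : j < n) (hnK : n ≤ K), PlaqSmall (c * θBal F.L γ b₀ p₀ n) (descendTo F ℰp n K hnK U) := by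
  obtain ⟨jV, hjV⟩ := spreadLift_height_all hc F hγ hγ1 hb hp
  have hLF : 1 ≤ F.L := F.hL.2.le
  have hθ0 : ∀ i, 0 ≤ θBal F.L γ b₀ p₀ i := fun i => (T3MinimiserStabilityReduction.θBal_pos hLF hγ hγ1 hb p₀ i).le
  refine ⟨jV, fun j hj K hjK => ?_⟩
  induction K, hjK using Nat.le_induction with
  | base =>
    intro V hV
    refine ⟨V, descendTo_self F ℰp j V, hV, fun n hjn hnK => absurd hnK (by omega)⟩
  | succ K hjK IH =>
    intro V hV
    obtain ⟨U, hUV, hUK, hUn⟩ := IH V hV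
    obtain ⟨U', hU'U, hU'⟩ := hjV K (hj.trans hjK) U hUK
    have hstep : descendTo F ℰp K (K + 1) (Nat.le_succ K) U' = U := by rw [← descend_eq_descendTo' F K (Nat.le_succ K) U', hU'U]
    refine ⟨U', ?_, fun p => (hU' p).trans_le ?_, fun n hjn hnK => ?_⟩
    · rw [← descendTo_descendTo F ℰp hjK (Nat.le_succ K), hstep, hUV]
    · have h := hθ0 (K + 1)
      nlinarith
    · rcases Nat.lt_or_ge K n with hlt | hle
      · have hn : n = K + 1 := by omega
        subst hn
        rw [descendTo_self]
        exact hU'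
      · rw [← descendTo_descendTo F ℰp hle (Nat.le_succ K), hstep]
        exact hUn n hjn hle

/-! ## §2 The AC step: `dU_j|_{W_j(b₀)} ≪ μ j` at every height from `jV` -/

/-- ★★★ **THE WINDOW CHARGES THE CUT TOWER**: for every `L`, `0 < b₀`, `0 < p₀` there is `γ₁ > 0` such that for every family of block size `L` and `0 < γ ≤ γ₁` there is a height
`jV` with: for every measurable cut `χ` that is NON-ZERO on the `(19∕20)·θ_i`-windows of the heights `(j, Ts]`, every run system `ν` and cut tower `μ` of S1aᴴ's shape,
every `jV ≤ j ≤ K` and every measurable `B ⊆ {PlaqSmall (θBal F.L γ b₀ p₀ j)}`: `μ j B = 0 ⟹ dU_j B = 0`.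
[cite: Balaban1985UV3, (2) p.256, (7) p.257 and (47) p.267; Balaban1987RG1, (2.10) p.267] -/
theorem window_absolutelyContinuous_tower (L : ℕ) {b₀ p₀ : ℝ} (hb : 0 < b₀) (hp : 0 < p₀) :
    ∃ γ₁ : ℝ, 0 < γ₁ ∧ ∀ (F : T3Family) (γ : ℝ), F.L = L → 0 < γ → γ ≤ γ₁ → ∃ jV : ℕ,
      ∀ (χ : (i : ℕ) → GaugeField (F.P i) 0 ↥(Matrix.specialUnitaryGroup (Fin 2) ℂ) → ℝ≥0∞), (∀ i, Measurable (χ i)) →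
      ∀ (ν : ℕ → (j : ℕ) → Measure (GaugeField (F.P j) 0 ↥(Matrix.specialUnitaryGroup (Fin 2) ℂ))),
        (∀ K, ν K K = T4GenFunBounds.gibbsMeasure (F.P K) ((F.scheme ℰp γ).β K)) →
        (∀ K j, j < K → ν K j = Measure.map (descend F ℰp j) (ν K (j + 1))) →
      ∀ (K Ts : ℕ) (hTs : Ts ≤ K) (μ : (j : ℕ) → Measure (GaugeField (F.P j) 0 ↥(Matrix.specialUnitaryGroup (Fin 2) ℂ))),
        (∀ j, Ts ≤ j → μ j = ν K j) →
        (∀ j, j < Ts → μ j = Measure.map (descend F ℰp j) ((μ (j + 1)).withDensity (χ (j + 1)))) →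
      ∀ (j : ℕ) (_ : jV ≤ j) (hjK : j ≤ K),
        (∀ (i : ℕ), j < i → i ≤ Ts → ∀ U, PlaqSmall (19 / 20 * θBal F.L γ b₀ p₀ i) U → χ i U ≠ 0) →
        ∀ B : Set (GaugeField (F.P j) 0 ↥(Matrix.specialUnitaryGroup (Fin 2) ℂ)), MeasurableSet B → B ⊆ {V | PlaqSmall (θBal F.L γ b₀ p₀ j) V} →
          μ j B = 0 → fieldMeasure (F.P j) 0 ↥(Matrix.specialUnitaryGroup (Fin 2) ℂ) B = 0 := by
  -- the lift floor `0.9482… < 19∕20`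
  have hc : (3874825 / 7077888 : ℝ) * Real.sqrt ((3 : ℕ) : ℝ) < 19 / 20 := by
    have hs : Real.sqrt ((3 : ℕ) : ℝ) < 19 / 20 * (7077888 / 3874825) := by
      rw [Real.sqrt_lt' (by norm_num)]
      norm_num
    have h2 := mul_lt_mul_of_pos_left hs (by norm_num : (0 : ℝ) < 3874825 / 7077888)
    have h3 : (3874825 / 7077888 : ℝ) * (19 / 20 * (7077888 / 3874825)) = 19 / 20 := by norm_num
    linarith [h2, h3]
  -- C2's coupling threshold, and the openness regime of `histGood`
  obtain ⟨γP, hγP, hP⟩ := regSet_and_pos_profile L b₀ p₀ hb hp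
  set δ₁ : ℝ := ExpMeanLog.deltaSU (Fin 2) / 2 / ((((3 + 2) * L : ℕ) : ℝ) ^ 2 / 4 + 1) with hδ₁def
  have hD : 0 < ((((3 + 2) * L : ℕ) : ℝ) ^ 2 / 4 + 1) := by positivity
  have hδ₁ : 0 < δ₁ := by rw [hδ₁def]; exact div_pos (half_pos ExpMeanLog.deltaSU_pos) hD
  obtain ⟨γO, hγO, hγO1, hθO⟩ := exists_gamma_forall_θBal_le (b₀ := b₀) (p₀ := p₀) hb hp hδ₁
  refine ⟨min γP γO, lt_min hγP hγO, fun F γ hFL hγ hγle => ?_⟩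
  have hγP' : γ ≤ γP := hγle.trans (min_le_left _ _)
  have hγO' : γ ≤ γO := hγle.trans (min_le_right _ _)
  have hγ1 : γ ≤ 1 := hγO'.trans hγO1
  have hLF : 1 ≤ F.L := F.hL.2.le
  have hθpos : ∀ i, 0 < θBal F.L γ b₀ p₀ i := fun i => T3MinimiserStabilityReduction.θBal_pos hLF hγ hγ1 hb p₀ i
  have hθδ : ∀ i, θBal F.L γ b₀ p₀ i ≤ δ₁ := fun i => by subst hFL; exact hθO F.L hLF γ hγ hγO' i
  -- the lift height
  obtain ⟨jV, hlift⟩ := exists_lift_profile hc (by norm_num) F hγ hγ1 hb hp.le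
  refine ⟨jV, fun χ hχm ν hν1 hν2 K Ts hTs μ hanch hcut j hjV hjK hχpos B hB hBW hμB => ?_⟩
  -- names
  set θ : ℕ → ℝ := θBal F.L γ b₀ p₀ with hθdef
  set c : ℝ := 19 / 20 with hcdef
  -- the two-parameter profile `θ″`: `θ` up to height `j`, `c·θ` above
  set θ'' : ℕ → ℝ := fun i => if i ≤ j then θ i else c * θ i with hθ''def
  have hθ''j : θ'' j = θ j := by simp [hθ''def]
  have hθ''gt : ∀ i, j < i → θ'' i = c * θ i := fun i hi => by simp [hθ''def, not_le.mpr hi]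
  have hθ''0 : ∀ i, 0 < θ'' i := by
    intro i
    by_cases hi : i ≤ j
    · rw [show θ'' i = θ i by simp [hθ''def, hi]]; exact hθpos i
    · rw [hθ''gt i (not_le.mp hi)]; exact mul_pos (by norm_num) (hθpos i)
  have hθ''le : ∀ i, θ'' i ≤ θ i := by
    intro i
    by_cases hi : i ≤ j
    · rw [show θ'' i = θ i by simp [hθ''def, hi]]
    · rw [hθ''gt i (not_le.mp hi), hcdef]; nlinarith [hθpos i]
  -- openness of `histGood θ″ K j`
  have hsmall : (((((F.P K).d + 2) * (F.P K).L : ℕ) : ℝ) ^ 2 / 4) * δ₁ ≤ ExpMeanLog.deltaSU (Fin 2) / 2 := by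
    have hd : (F.P K).d = 3 := T3Family.P_d F K
    have hLL : (F.P K).L = F.L := rfl
    rw [hd, hLL, hFL, hδ₁def, mul_div_assoc', div_le_iff₀ hD]
    have hq : 0 ≤ ExpMeanLog.deltaSU (Fin 2) / 2 := (half_pos ExpMeanLog.deltaSU_pos).le
    nlinarith [hq]
  have hopen : IsOpen (histGood F ℰp θ'' K j) := isOpen_histGood F hδ₁.le (fun i => (hθ''le i).trans (hθδ i)) hsmall hjK
  set E'' : Set (GaugeField (F.P K) 0 ↥(Matrix.specialUnitaryGroup (Fin 2) ℂ)) := histGood F ℰp θ'' K j with hE''def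
  have hE''m : MeasurableSet E'' := measurableSet_histGood F ℰp measurableE_ℰp _ K j
  -- INTERIOR at every window point, by the iterated spread lift
  have hint : ∀ V : GaugeField (F.P j) 0 ↥(Matrix.specialUnitaryGroup (Fin 2) ℂ), PlaqSmall (θ j) V →
      ∃ U, descendTo F ℰp j K hjK U = V ∧ U ∈ interior E'' := by
    intro V hV
    obtain ⟨U, hUV, -, hUn⟩ := hlift j hjV K hjK V hV
    refine ⟨U, hUV, ?_⟩
    rw [hopen.interior_eq, hE''def, histGood_iff_descendTo]
    intro n hjn hnK
    rcases hjn.lt_or_eq with hlt | heq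
    · rw [hθ''gt n hlt]; exact hUn n hlt hnK
    · subst heq
      rw [hθ''j, hUV]; exact hV
  -- C2: positivity of the canonical `E″`-restricted density on the whole `θ_j`-window
  obtain ⟨-, hPos⟩ := hP F γ hFL hγ hγP' θ'' hθ''0 hθ''le j K hjK γ hγ
  have hcanpos : ∀ V : GaugeField (F.P j) 0 ↥(Matrix.specialUnitaryGroup (Fin 2) ℂ), PlaqSmall (θ j) V → 0 < heightDensityCan F γ hjK E'' V :=
    fun V hV => hPos V (by rw [hθ''j]; exact hV) (hint V hV)
  -- THE DOWNWARD INDUCTION: `μ j B = 0 ⟹ Gibbs_K (E_j ∩ D_{j,K}⁻¹ B) = 0`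
  have hmono : ∀ {s t : Set (GaugeField (F.P K) 0 ↥(Matrix.specialUnitaryGroup (Fin 2) ℂ))}, s ⊆ t → gibbsK F ℰp γ K t = 0 → gibbsK F ℰp γ K s = 0 :=
    fun hst ht => measure_mono_null hst ht
  have key : ∀ (n j : ℕ) (hjK : j ≤ K), Ts ≤ j + n →
      (∀ (i : ℕ), j < i → i ≤ Ts → ∀ U, PlaqSmall (c * θ i) U → χ i U ≠ 0) →
      ∀ B : Set (GaugeField (F.P j) 0 ↥(Matrix.specialUnitaryGroup (Fin 2) ℂ)), MeasurableSet B → μ j B = 0 →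
        gibbsK F ℰp γ K ({U | ∀ (i : ℕ) (_ : j < i) (hiT : i ≤ Ts), PlaqSmall (c * θ i) (descendTo F ℰp i K (hiT.trans hTs) U)} ∩
          descendTo F ℰp j K hjK ⁻¹' B) = 0 := by
    -- at and above the seed height: `μ j` IS the descended Gibbs measure
    have htop : ∀ (j : ℕ) (hjK : j ≤ K), Ts ≤ j → ∀ B : Set (GaugeField (F.P j) 0 ↥(Matrix.specialUnitaryGroup (Fin 2) ℂ)), MeasurableSet B → μ j B = 0 →
        gibbsK F ℰp γ K ({U | ∀ (i : ℕ) (_ : j < i) (hiT : i ≤ Ts), PlaqSmall (c * θ i) (descendTo F ℰp i K (hiT.trans hTs) U)} ∩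
          descendTo F ℰp j K hjK ⁻¹' B) = 0 := by
      intro j hjK hj B hB hμB
      rw [hanch j hj, run_eq_map_descendTo F ν hν1 hν2 hjK, Measure.map_apply (measurable_descendTo F ℰp measurableE_ℰp hjK) hB] at hμB
      exact hmono Set.inter_subset_right hμB
    intro n
    induction n with
    | zero =>
      intro j hjK hj _ B hB hμB
      exact htop j hjK (by omega) B hB hμB
    | succ n ih =>
      intro j hjK hj hχpos B hB hμB
      rcases le_or_gt Ts j with hTj | hjT
      · exact htop j hjK hTj B hB hμB
      have hjK' : j + 1 ≤ K := by omega
      have hd : Measurable (descend F ℰp j : GaugeField (F.P (j + 1)) 0 ↥(Matrix.specialUnitaryGroup (Fin 2) ℂ) →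
          GaugeField (F.P j) 0 ↥(Matrix.specialUnitaryGroup (Fin 2) ℂ)) := measurable_descend F ℰp measurableE_ℰp j
      -- `μ j B = ∫⁻_{descend⁻¹ B} χ_{j+1} dμ_{j+1} = 0`: the cut weight vanishes `μ_{j+1}`-a.e. over `B`
      have hB1 : MeasurableSet (descend F ℰp j ⁻¹' B) := hd hB
      rw [hcut j hjT, Measure.map_apply hd hB, withDensity_apply _ hB1] at hμB
      have hae : ∀ᵐ U ∂(μ (j + 1)), U ∈ descend F ℰp j ⁻¹' B → χ (j + 1) U = 0 := by
        have h0 := (lintegral_eq_zero_iff (hχm (j + 1))).mp hμB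
        exact (ae_restrict_iff' hB1).mp h0
      set B' : Set (GaugeField (F.P (j + 1)) 0 ↥(Matrix.specialUnitaryGroup (Fin 2) ℂ)) := descend F ℰp j ⁻¹' B ∩ {U | χ (j + 1) U ≠ 0} with hB'def
      have hB'm : MeasurableSet B' := hB1.inter ((hχm (j + 1)) (measurableSet_singleton 0).compl)
      have hμB' : μ (j + 1) B' = 0 := by
        rw [measure_eq_zero_iff_ae_notMem]
        filter_upwards [hae] with U hU hUB'
        exact hUB'.2 (hU hUB'.1)
      -- the induction hypothesis one level up, on `B'`
      have hIH := ih (j + 1) hjK' (by omega) (fun i hi hiT U hU => hχpos i (by omega) hiT U hU) B' hB'm hμB'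
      refine hmono ?_ hIH
      rintro U ⟨hUE, hUB⟩
      have hcomp : descend F ℰp j (descendTo F ℰp (j + 1) K hjK' U) = descendTo F ℰp j K hjK U := by
        rw [descend_eq_descendTo' F j (Nat.le_succ j), descendTo_descendTo]
      refine ⟨fun i hi hiT => hUE i (by omega) hiT, ?_, ?_⟩
      · show descend F ℰp j (descendTo F ℰp (j + 1) K hjK' U) ∈ B
        rw [hcomp]; exact hUB
      · exact hχpos (j + 1) (by omega) (by omega) _ (hUE (j + 1) (by omega) (by omega))
  -- apply it at `j` and pass to `E″ = histGood θ″ K j ⊆ E_j`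
  have hkey := key (Ts - j + 1) j hjK (by omega) hχpos B hB hμB
  have hGE : gibbsK F ℰp γ K (descendTo F ℰp j K hjK ⁻¹' B ∩ E'') = 0 := by
    refine hmono ?_ hkey
    rintro U ⟨hUB, hUE⟩
    refine ⟨fun i hji hiT => ?_, hUB⟩
    have h := (histGood_iff_descendTo F).mp hUE i hji.le (hiT.trans hTs)
    rwa [hθ''gt i hji] at h
  -- hence the descended restricted Gibbs measure, i.e. `Z_K⁻¹·heightDensity E″ · dU`, does not charge `B`
  have hwd : (fieldMeasure (F.P j) 0 ↥(Matrix.specialUnitaryGroup (Fin 2) ℂ)).withDensity (fun V => ENNReal.ofReal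
      ((partitionFn (G := ↥(Matrix.specialUnitaryGroup (Fin 2) ℂ)) (F.P K) ((F.scheme ℰp γ).β K))⁻¹ * heightDensity F γ hjK E'' V)) B = 0 := by
    rw [← map_descendTo_restrict_eq_withDensity F hjK hE''m hγ.le, Measure.map_apply (measurable_descendTo F ℰp measurableE_ℰp hjK) hB,
      Measure.restrict_apply (measurable_descendTo F ℰp measurableE_ℰp hjK hB), hGE]
  rw [withDensity_apply _ hB] at hwd
  have hwd' := (lintegral_eq_zero_iff (((heightDensity_props F hjK hE''m hγ.le).1.const_mul
    ((partitionFn (G := ↥(Matrix.specialUnitaryGroup (Fin 2) ℂ)) (F.P K) ((F.scheme ℰp γ).β K))⁻¹)).ennreal_ofReal)).mp hwd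
  have hae0 : ∀ᵐ V ∂fieldMeasure (F.P j) 0 ↥(Matrix.specialUnitaryGroup (Fin 2) ℂ), V ∈ B →
      ENNReal.ofReal ((partitionFn (G := ↥(Matrix.specialUnitaryGroup (Fin 2) ℂ)) (F.P K) ((F.scheme ℰp γ).β K))⁻¹ * heightDensity F γ hjK E'' V) = 0 :=
    (ae_restrict_iff' hB).mp hwd'
  have hcan : heightDensityCan F γ hjK E'' =ᵐ[fieldMeasure (F.P j) 0 ↥(Matrix.specialUnitaryGroup (Fin 2) ℂ)] heightDensity F γ hjK E'' :=
    Node00.canonVersion_ae_eq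
  have hZ : 0 < partitionFn (G := ↥(Matrix.specialUnitaryGroup (Fin 2) ℂ)) (F.P K) ((F.scheme ℰp γ).β K) := partitionFn_pos' _ (F.scheme_β_nonneg ℰp hγ.le K)
  rw [measure_eq_zero_iff_ae_notMem]
  filter_upwards [hae0, hcan] with V h0 h1 hVB
  have hpos : 0 < (partitionFn (G := ↥(Matrix.specialUnitaryGroup (Fin 2) ℂ)) (F.P K) ((F.scheme ℰp γ).β K))⁻¹ * heightDensity F γ hjK E'' V := by
    rw [← h1]; exact mul_pos (inv_pos.mpr hZ) (hcanpos V (hBW hVB))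
  have := h0 hVB
  rw [ENNReal.ofReal_eq_zero] at this
  exact absurd this (not_le.mpr hpos)

/-! ## §3 (p) ∧ (w) for ONE measurable version on the FULL window -/

/-- ★★★ **S1aᴴ's (p) ∧ (w) ON THE FULL WINDOW, FOR ONE MEASURABLE VERSION**: for every `L`, `0 < b₀`, `0 < p₀` there is `γ₁ > 0` such that for every family of block size `L` and
`0 < γ ≤ γ₁` there is a height `jV` with: for every measurable cut `χ ≤ 1` NON-ZERO on the `(19∕20)·θ_i`-windows of the heights `(j, Ts]` (the line's `sfCut (θBal F.L γ b₀ p₀ i)`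
qualifies), every run system `ν` and cut tower `μ` of S1aᴴ's shape and every `jV ≤ j ≤ K`, the law `μ j` has a MEASURABLE density `ρ ≥ 0` with
`μ j = dU_j.withDensity (ofReal ∘ ρ)`, `0 < ρ V` at EVERY `V` of the `θBal F.L γ b₀ p₀ j`-window (S1aᴴ's (p) as typed, the cut's own `b₀`), and `ρ ≤ Z_K⁻¹·heightDensity … univ`
a.e. (✓`tower_le_run`).  [cite: Balaban1985UV3, (2) p.256, (7) p.257 and (47) p.267; Balaban1987RG1, (2.10) p.267] -/
theorem exists_density_pos_on_fullWindow (L : ℕ) {b₀ p₀ : ℝ} (hb : 0 < b₀) (hp : 0 < p₀) :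
    ∃ γ₁ : ℝ, 0 < γ₁ ∧ ∀ (F : T3Family) (γ : ℝ), F.L = L → 0 < γ → γ ≤ γ₁ → ∃ jV : ℕ,
      ∀ (χ : (i : ℕ) → GaugeField (F.P i) 0 ↥(Matrix.specialUnitaryGroup (Fin 2) ℂ) → ℝ≥0∞), (∀ i, Measurable (χ i)) → (∀ i U, χ i U ≤ 1) →
      ∀ (ν : ℕ → (j : ℕ) → Measure (GaugeField (F.P j) 0 ↥(Matrix.specialUnitaryGroup (Fin 2) ℂ))),
        (∀ K, ν K K = T4GenFunBounds.gibbsMeasure (F.P K) ((F.scheme ℰp γ).β K)) →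
        (∀ K j, j < K → ν K j = Measure.map (descend F ℰp j) (ν K (j + 1))) →
      ∀ (K Ts : ℕ) (hTs : Ts ≤ K) (μ : (j : ℕ) → Measure (GaugeField (F.P j) 0 ↥(Matrix.specialUnitaryGroup (Fin 2) ℂ))),
        (∀ j, Ts ≤ j → μ j = ν K j) →
        (∀ j, j < Ts → μ j = Measure.map (descend F ℰp j) ((μ (j + 1)).withDensity (χ (j + 1)))) →
      ∀ (j : ℕ) (_ : jV ≤ j) (hjK : j ≤ K),
        (∀ (i : ℕ), j < i → i ≤ Ts → ∀ U, PlaqSmall (19 / 20 * θBal F.L γ b₀ p₀ i) U → χ i U ≠ 0) →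
        ∃ ρ : GaugeField (F.P j) 0 ↥(Matrix.specialUnitaryGroup (Fin 2) ℂ) → ℝ, Measurable ρ ∧ (∀ V, 0 ≤ ρ V) ∧
          μ j = (fieldMeasure (F.P j) 0 ↥(Matrix.specialUnitaryGroup (Fin 2) ℂ)).withDensity (fun V => ENNReal.ofReal (ρ V)) ∧
          (∀ V, PlaqSmall (θBal F.L γ b₀ p₀ j) V → 0 < ρ V) ∧
          (∀ᵐ V ∂fieldMeasure (F.P j) 0 ↥(Matrix.specialUnitaryGroup (Fin 2) ℂ),
            ρ V ≤ (partitionFn (G := ↥(Matrix.specialUnitaryGroup (Fin 2) ℂ)) (F.P K) ((F.scheme ℰp γ).β K))⁻¹ * heightDensity F γ hjK Set.univ V) := by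
  classical
  obtain ⟨γ₁, hγ₁, H⟩ := window_absolutelyContinuous_tower L hb hp
  refine ⟨γ₁, hγ₁, fun F γ hFL hγ hγle => ?_⟩
  obtain ⟨jV, HV⟩ := H F γ hFL hγ hγle
  refine ⟨jV, fun χ hχm hχ1 ν hν1 hν2 K Ts hTs μ hanch hcut j hjV hjK hχpos => ?_⟩
  have hAC := HV χ hχm ν hν1 hν2 K Ts hTs μ hanch hcut j hjV hjK hχpos
  haveI : BorelSpace (GaugeField (F.P j) 0 ↥(Matrix.specialUnitaryGroup (Fin 2) ℂ)) := T3OrbitAverage.instBorelSpaceGaugeField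
  set W : Set (GaugeField (F.P j) 0 ↥(Matrix.specialUnitaryGroup (Fin 2) ℂ)) := {V | PlaqSmall (θBal F.L γ b₀ p₀ j) V} with hWdef
  have hWm : MeasurableSet W := (isOpen_window _).measurableSet
  -- the law `μ j`: absolutely continuous, finite; its Radon–Nikodym density `r`
  have hμAC : μ j ≪ fieldMeasure (F.P j) 0 ↥(Matrix.specialUnitaryGroup (Fin 2) ℂ) :=
    tower_absolutelyContinuous F χ ν μ hγ.le hχ1 hν1 hν2 hTs hanch hcut hjK
  haveI : IsFiniteMeasure (μ j) := isFiniteMeasure_tower F χ ν μ hγ.le hχ1 hν1 hν2 hTs hanch hcut hjK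
  set r : GaugeField (F.P j) 0 ↥(Matrix.specialUnitaryGroup (Fin 2) ℂ) → ℝ≥0∞ :=
    (μ j).rnDeriv (fieldMeasure (F.P j) 0 ↥(Matrix.specialUnitaryGroup (Fin 2) ℂ)) with hrdef
  have hμr : μ j = (fieldMeasure (F.P j) 0 ↥(Matrix.specialUnitaryGroup (Fin 2) ℂ)).withDensity r :=
    (Measure.withDensity_rnDeriv_eq _ _ hμAC).symm
  have hrm : Measurable r := Measure.measurable_rnDeriv _ _
  have hrtop : ∀ᵐ V ∂fieldMeasure (F.P j) 0 ↥(Matrix.specialUnitaryGroup (Fin 2) ℂ), r V < ⊤ := Measure.rnDeriv_lt_top _ _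
  -- the bad set `W ∩ {r = 0 ∨ r = ⊤}` is Haar-null: `{r = 0}` is `μ j`-null, hence Haar-null inside `W` (§2); `{r = ⊤}` is Haar-null
  set N : Set (GaugeField (F.P j) 0 ↥(Matrix.specialUnitaryGroup (Fin 2) ℂ)) := W ∩ {V | r V = 0 ∨ r V = ⊤} with hNdef
  have hN0m : MeasurableSet {V : GaugeField (F.P j) 0 ↥(Matrix.specialUnitaryGroup (Fin 2) ℂ) | r V = 0} := hrm (measurableSet_singleton 0)
  have hNtm : MeasurableSet {V : GaugeField (F.P j) 0 ↥(Matrix.specialUnitaryGroup (Fin 2) ℂ) | r V = ⊤} := hrm (measurableSet_singleton ⊤)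
  have hNm : MeasurableSet N := hWm.inter (hN0m.union hNtm)
  have hμ0 : μ j (W ∩ {V | r V = 0}) = 0 := by
    rw [hμr, withDensity_apply _ (hWm.inter hN0m), lintegral_eq_zero_iff hrm]
    exact (ae_restrict_iff' (hWm.inter hN0m)).mpr (ae_of_all _ fun V hV => hV.2)
  have hdU0 : fieldMeasure (F.P j) 0 ↥(Matrix.specialUnitaryGroup (Fin 2) ℂ) (W ∩ {V | r V = 0}) = 0 :=
    hAC _ (hWm.inter hN0m) Set.inter_subset_left hμ0
  have hdUt : fieldMeasure (F.P j) 0 ↥(Matrix.specialUnitaryGroup (Fin 2) ℂ) {V | r V = ⊤} = 0 := by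
    rw [measure_eq_zero_iff_ae_notMem]
    filter_upwards [hrtop] with V hV hVt
    exact (lt_irrefl _) (lt_of_eq_of_lt hVt.symm hV)
  have hN : fieldMeasure (F.P j) 0 ↥(Matrix.specialUnitaryGroup (Fin 2) ℂ) N = 0 := by
    refine measure_mono_null (fun V hV => ?_) (measure_union_null hdU0 hdUt)
    rcases hV.2 with h | h
    · exact Or.inl ⟨hV.1, h⟩
    · exact Or.inr h
  -- the version
  set ρ : GaugeField (F.P j) 0 ↥(Matrix.specialUnitaryGroup (Fin 2) ℂ) → ℝ := N.piecewise (fun _ => 1) (fun V => (r V).toReal) with hρdef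
  have hρm : Measurable ρ := Measurable.piecewise hNm measurable_const hrm.ennreal_toReal
  have hρ_of_mem : ∀ V ∈ N, ρ V = 1 := fun V hV => Set.piecewise_eq_of_mem _ _ _ hV
  have hρ_of_not_mem : ∀ V ∉ N, ρ V = (r V).toReal := fun V hV => Set.piecewise_eq_of_notMem _ _ _ hV
  have hρr : ∀ᵐ V ∂fieldMeasure (F.P j) 0 ↥(Matrix.specialUnitaryGroup (Fin 2) ℂ), ρ V = (r V).toReal := by
    filter_upwards [(measure_eq_zero_iff_ae_notMem.mp hN)] with V hV
    exact hρ_of_not_mem V hV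
  refine ⟨ρ, hρm, fun V => ?_, ?_, fun V hV => ?_, ?_⟩
  · by_cases hV : V ∈ N
    · rw [hρ_of_mem V hV]; exact zero_le_one
    · rw [hρ_of_not_mem V hV]; exact ENNReal.toReal_nonneg
  · rw [hμr]
    refine withDensity_congr_ae ?_
    filter_upwards [hρr, hrtop] with V h1 h2
    rw [h1, ENNReal.ofReal_toReal h2.ne]
  · by_cases hVN : V ∈ N
    · rw [hρ_of_mem V hVN]; exact one_pos
    · rw [hρ_of_not_mem V hVN]
      have h' : r V ≠ 0 ∧ r V ≠ ⊤ := not_or.mp fun h => hVN ⟨hV, h⟩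
      exact ENNReal.toReal_pos h'.1 h'.2
  · have hle := tower_le_run F χ ν μ hχ1 hν2 hTs hanch hcut j
    rw [hμr, run_eq_withDensity_heightDensity_univ F hγ.le ν hν1 hν2 hjK] at hle
    have hup := ae_le_of_withDensity_le hrm hle
    have hZ : 0 < partitionFn (G := ↥(Matrix.specialUnitaryGroup (Fin 2) ℂ)) (F.P K) ((F.scheme ℰp γ).β K) := partitionFn_pos' _ (F.scheme_β_nonneg ℰp hγ.le K)
    filter_upwards [hup, hρr] with V h1 h2
    have h0 : 0 ≤ (partitionFn (G := ↥(Matrix.specialUnitaryGroup (Fin 2) ℂ)) (F.P K) ((F.scheme ℰp γ).β K))⁻¹ * heightDensity F γ hjK Set.univ V :=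
      mul_nonneg (inv_nonneg.mpr hZ.le) (heightDensity_nonneg F γ hjK _ V)
    rw [h2]
    exact ENNReal.toReal_le_of_le_ofReal h0 h1

end Summit.QuantumFields.YangMills.Theorems.FluctuationComparisonRegPrIntLS1aTowerFullWindow

end
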